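import Summits.QuantumFields.YangMills.Theorems.LuscherReductionTwistedTraceScalingBOCentralChartCore
import HarnessLib

/-!
# (C1d-γ) ★★★ THE CENTRAL GAUSSIAN AGAINST PRODUCT HAAR: `∫_V K_β(P(w'), V)·G(V) dμ(V) ∈ [lo, hi]·stiffGaussTop·e^{−q(chartVec w')}` for any `G` two-sided Gaussian on the chart core
# (lane A of S-BASE, crux `TwistedTraceScaling` stmt-QuantumFields-20203, C4-CORE, the (OD) pen, brick (C1d) of `pub/ym-fleet/ym-luscher-20007-p1/COARSE-DESIGN.md` §27.8–§27.9)

Data: `β > 0`, a chart radius `0 < ρ ≤ 1/2`, a centre radius `ρ'` with `4ρ' ≤ ρ`, a centre `U' = P(w')` on the vacuum pattern of the lattice gnomonic chart with `Σ_a w'_e a² ≤ ρ'²` on every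
link, and a bounded measurable `G ≥ 0` on `SU(2)^E` which on the chart ball is Gaussian from below / above: `g₋·e^{−q(chartVec w)} ≤ G(P(w))` resp. `G(P(w)) ≤ g₊·e^{−q(chartVec w)}`
whenever `Σ_a w_e a² ≤ ρ²` on every link (`q = stiffGaussExp L (β/2) β`, whose `e^{−q}` is the ground state of the harmonic stiff kernel at `(t,b) = (β/2, β)`).
★★★ `central_gaussian_lower`:  `e^{2β|E|}((2π²)⁻¹(1+ρ²)⁻²)^{|E|}e^{−2000|P|ρ³β}·g₋·(stiffGaussTop·e^{−q(x')} − e^{−β(ρ−ρ')²/2}(π/(β/2))^{3|E|/2}) ≤ ∫ K_β(P w', V)G(V)dμ(V)`;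
★★★ `central_gaussian_upper`:  `∫ K_β(P w', V)G(V)dμ(V) ≤ e^{2β|E|}(2π²)^{−|E|}e^{2000|P|ρ³β + 8|E|βρ⁴}·g₊·stiffGaussTop·e^{−q(x')} + C_G·e^{2β|E|}e^{−βρ²/4}`  (`x' = chartVec w'`).
Mechanism: split `∫ = ∫_{gnCore ρ} + ∫_{off}`; off the core `K ≤ e^{2β|E|}e^{−βρ²/4}` (`…BOCentralChartCore.transferKernel_far_le`); on the core pass to the chart (`core_part_eq_chart`), sandwich
the integrand against the flat model (`chart_integrand_lower/upper`), and evaluate the model (`…BOCentralModel.model_integral_chart`, `model_integral_chart_core_ge`).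
With `ρ = β^{-1/2}·polylog` every multiplicative correction is `e^{±β^{-1/2}polylog}` and both tails are `e^{−polylog²}` against `e^{−q(x')} ≥ e^{−O(log²β)}` on the fibre core: this is (C1d)
of §27.9 for an ABSTRACT comparison function.  In the glue `…BOCentralGlue.central_transfer_two_sided_of_bricks` one may now take `G := A_W(χ₀⊗Ω_G)` ITSELF (`hC1c` with `m_c = M_c = 1`), so
that the whole analytic content of (C1) is: (C1c') `A_W(χ₀⊗Ω_G)(P w)` is two-sided Gaussian in `q(chartVec w)` on the chart ball around the fibre points of the inner core — this also
disposes of cdisprove's CAUTION 2 (g36) on the pointwise shape of `hC1c`.  The identification `orthoTube L 1 v' = P(w'(v'))` and `q(chartVec w') = q(linkEmbed v') + O(β|v'|⁴)` are next.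
HONEST FRAMING: Laplace evaluation for a stub of a child of the CONDITIONAL route R2b1; (C1c'), (C4), (C5), (B-ST) OPEN; C4-CORE OPEN; not infinite volume, not a gap, not Clay.
-/

set_option autoImplicit false

noncomputable section

open MeasureTheory Filter Topology Real
open scoped BigOperators RealInnerProductSpace
open Literature.MathematicalPhysics.QuantumFieldTheory
open Literature.MathematicalPhysics.QuantumLattice
open Literature.MathematicalPhysics.QuantumFieldTheory.Balaban1983to89.T4CubeChartGnomonic (gnoPoint)

namespace Summit.QuantumFields.YangMills.Theorems.FemtoTransferGap.TwoLattice.ConstTube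

open Summit.QuantumFields.YangMills.Theorems.FemtoTransferGap
open Summit.QuantumFields.YangMills.Theorems.FemtoTransferGap.TwoLattice
open Summit.QuantumFields.YangMills.Theorems.FemtoTransferGap.TwoLattice.Stiff
open Summit.QuantumFields.YangMills.Theorems.FemtoTransferGap.TwoLattice.GnChart
open Summit.QuantumFields.YangMills.Theorems.FemtoTransferGap.TwoLattice.Chart (frobNorm_sub_sq_eq)
open Summit.QuantumFields.YangMills.Theorems.FemtoTransferGap.TwoLattice.Electric (latE_eq_exp_frobSq)

variable {L : ℕ} [NeZero L]

/-- ★★★ **THE CENTRAL GAUSSIAN, LOWER BOUND.**  For `β > 0`, `0 < ρ ≤ 1/2`, `0 ≤ ρ'`, `4ρ' ≤ ρ`, a centre `P(w')` with `Σ_a w'_e a² ≤ ρ'²` on every link, and a measurable `G ≥ 0` with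
`g₋·e^{−q(chartVec w)} ≤ G(P w)` on the ball `Σ_a w_e a² ≤ ρ²` (`g₋ ≥ 0`, `q = stiffGaussExp L (β/2) β`) and `|G| ≤ C_G`:
`e^{2β|E|}((2π²)⁻¹(1+ρ²)⁻²)^{|E|}e^{−2000|P|ρ³β}·g₋·(stiffGaussTop L (β/2) β·e^{−q(chartVec w')} − e^{−β(ρ−ρ')²/2}(π/(β/2))^{dim/2}) ≤ ∫ K_β(P w', V)·G(V) dμ(V)`.
[cite: Luscher1983, §3] [cite: Wipf2021, §8.5.2] -/
theorem central_gaussian_lower {β : ℝ} (hβ : 0 < β) {ρ ρ' : ℝ} (hρ : 0 < ρ) (hρ2 : ρ ≤ 1 / 2) (hρ'0 : 0 ≤ ρ') (hρ' : 4 * ρ' ≤ ρ) {w' : Edge 3 L → Fin 3 → ℝ}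
    (hw' : ∀ e, ∑ a, w' e a ^ 2 ≤ ρ' ^ 2) {G : GaugeConfig 3 L SU2 → ℝ} (hGm : Measurable G) {CG : ℝ} (hCG : ∀ V, |G V| ≤ CG) (hG0 : ∀ V, 0 ≤ G V) {gm : ℝ} (hgm : 0 ≤ gm)
    (hGlo : ∀ w : Edge 3 L → Fin 3 → ℝ, (∀ e, ∑ a, w e a ^ 2 ≤ ρ ^ 2) → gm * Real.exp (-stiffGaussExp L (β / 2) β (chartVec w)) ≤ G (latPatternChart L (fun _ => false) w)) :
    Real.exp (2 * β) ^ Fintype.card (Edge 3 L) * ((2 * π ^ 2)⁻¹ * ((1 + ρ ^ 2)⁻¹) ^ 2) ^ Fintype.card (Edge 3 L) *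
          Real.exp (-(2000 * Fintype.card (Plaquette 3 L) * ρ ^ 3 * β)) * gm *
        (stiffGaussTop L (β / 2) β * Real.exp (-stiffGaussExp L (β / 2) β (chartVec w')) -
          Real.exp (-(β * (ρ - ρ') ^ 2 / 2)) * (π / (β / 2)) ^ ((Module.finrank ℝ (LinkSpace L) : ℝ) / 2)) ≤
      ∫ V, transferKernel su2Rep β (latPatternChart L (fun _ => false) w') V * G V ∂configMeasure SU2 L := by
  have hβ0 : 0 ≤ β := hβ.le
  have hρ'ρ : ρ' ≤ ρ := by linarith
  have hw'ρ : ∀ e, ∑ a, w' e a ^ 2 ≤ ρ ^ 2 := fun e => (hw' e).trans (pow_le_pow_left₀ hρ'0 hρ'ρ 2)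
  have hCG0 : 0 ≤ CG := (abs_nonneg _).trans (hCG 1)
  set U' := latPatternChart L (fun _ => false) w' with hU'
  set ball : Set (Edge 3 L → Fin 3 → ℝ) := {w | ∀ e, ∑ a, w e a ^ 2 ≤ ρ ^ 2} with hball
  set c : ℝ := Real.exp (2 * β) ^ Fintype.card (Edge 3 L) * ((2 * π ^ 2)⁻¹ * ((1 + ρ ^ 2)⁻¹) ^ 2) ^ Fintype.card (Edge 3 L) *
    Real.exp (-(2000 * Fintype.card (Plaquette 3 L) * ρ ^ 3 * β)) * gm with hc
  set chi : ℝ := Real.exp (2 * β) ^ Fintype.card (Edge 3 L) * ((2 * π ^ 2)⁻¹) ^ Fintype.card (Edge 3 L) * Real.exp (2000 * Fintype.card (Plaquette 3 L) * ρ ^ 3 * β) *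
    Real.exp (8 * Fintype.card (Edge 3 L) * β * ρ ^ 4) with hchi
  have hc0 : 0 ≤ c := by positivity
  have hchi0 : 0 ≤ chi := by positivity
  -- the flat model integrand and the chart integrand
  set m : (Edge 3 L → Fin 3 → ℝ) → ℝ := fun w => Real.exp (-⟪chartVec w', ((β / 2) • stiffHessian L) (chartVec w')⟫) * Real.exp (-(β * ‖chartVec w' - chartVec w‖ ^ 2)) *
    Real.exp (-⟪chartVec w, ((β / 2) • stiffHessian L) (chartVec w)⟫) * Real.exp (-stiffGaussExp L (β / 2) β (chartVec w)) with hm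
  set F : (Edge 3 L → Fin 3 → ℝ) → ℝ := fun w => ball.indicator (fun w => latGnDensityReal L w * transferKernel su2Rep β U' (latPatternChart L (fun _ => false) w) *
    G (latPatternChart L (fun _ => false) w)) w with hF
  obtain ⟨M, hM0, hM, hintKG, hintS⟩ := integrable_transferKernel_mul β U' hGm hCG
  -- (1) `∫ K G ≥ ∫ 𝟙_core K G`
  have h1 : ∫ V, (gnCore L ρ).indicator (fun V => transferKernel su2Rep β U' V * G V) V ∂configMeasure SU2 L ≤ ∫ V, transferKernel su2Rep β U' V * G V ∂configMeasure SU2 L := by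
    refine integral_mono (hintS _ (measurableSet_gnCore ρ)) hintKG fun V => ?_
    beta_reduce
    by_cases hV : V ∈ gnCore L ρ
    · rw [Set.indicator_of_mem hV]
    · rw [Set.indicator_of_notMem hV]; exact mul_nonneg (transferKernel_pos su2Rep β _ _).le (hG0 V)
  -- (2) the core part in the chart
  have h2 : ∫ V, (gnCore L ρ).indicator (fun V => transferKernel su2Rep β U' V * G V) V ∂configMeasure SU2 L = ∫ w, F w := core_part_eq_chart β ρ w' hGm hCG
  -- (3) integrability of the chart integrand: dominated by a shifted Gaussian
  have hFm : Measurable F := measurable_chart_integrand β ρ w' hGm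
  have hF0 : ∀ w, 0 ≤ F w := fun w => by
    simp only [hF]
    by_cases hw : w ∈ ball
    · rw [Set.indicator_of_mem hw]
      exact mul_nonneg (mul_nonneg (latGnDensityReal_pos_le L w).1.le (transferKernel_pos su2Rep β _ _).le) (hG0 _)
    · rw [Set.indicator_of_notMem hw]
  have hFle : ∀ w, F w ≤ chi * CG * Real.exp (-(β * ‖chartVec w' - chartVec w‖ ^ 2)) := fun w => by
    simp only [hF]
    by_cases hw : w ∈ ball
    · rw [Set.indicator_of_mem hw]
      have h := chart_integrand_upper (L := L) hβ0 hρ.le hρ2 hw hw'ρ (hG0 _) ((le_abs_self _).trans (hCG (latPatternChart L (fun _ => false) w)))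
      refine h.trans ?_
      have hE1 : Real.exp (-⟪chartVec w', ((β / 2) • stiffHessian L) (chartVec w')⟫) ≤ 1 :=
        Real.exp_le_one_iff.2 (neg_nonpos.2 (inner_smul_stiffHessian_nonneg (by positivity) _))
      have hE3 : Real.exp (-⟪chartVec w, ((β / 2) • stiffHessian L) (chartVec w)⟫) ≤ 1 :=
        Real.exp_le_one_iff.2 (neg_nonpos.2 (inner_smul_stiffHessian_nonneg (by positivity) _))
      have hE2 : 0 ≤ Real.exp (-(β * ‖chartVec w' - chartVec w‖ ^ 2)) := (Real.exp_pos _).le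
      rw [← hchi]
      calc chi * CG * (Real.exp (-⟪chartVec w', ((β / 2) • stiffHessian L) (chartVec w')⟫) * Real.exp (-(β * ‖chartVec w' - chartVec w‖ ^ 2)) *
            Real.exp (-⟪chartVec w, ((β / 2) • stiffHessian L) (chartVec w)⟫))
          ≤ chi * CG * (1 * Real.exp (-(β * ‖chartVec w' - chartVec w‖ ^ 2)) * 1) := by gcongr
        _ = chi * CG * Real.exp (-(β * ‖chartVec w' - chartVec w‖ ^ 2)) := by ring
    · rw [Set.indicator_of_notMem hw]; positivity
  have hFint : Integrable F := Integrable.mono' ((integrable_gauss_shift_chart hβ (chartVec w')).const_mul (chi * CG)) hFm.aestronglyMeasurable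
    (ae_of_all _ fun w => by rw [Real.norm_eq_abs, abs_of_nonneg (hF0 w)]; exact hFle w)
  -- (4) the chart integrand dominates `c · 𝟙_ball · m`
  have h4 : ∫ w, ball.indicator (fun w => c * m w) w ≤ ∫ w, F w := by
    refine integral_mono_of_nonneg (ae_of_all _ fun w => Set.indicator_nonneg (fun w _ => ?_) _) hFint (ae_of_all _ fun w => ?_)
    · simp only [hm]; exact mul_nonneg hc0 (model_integrand_nonneg (β / 2) β (chartVec w') (chartVec w))
    · simp only [hF, hm, hc]
      by_cases hw : w ∈ ball
      · rw [Set.indicator_of_mem hw, Set.indicator_of_mem hw]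
        exact chart_integrand_lower (L := L) hβ0 hρ.le hρ2 hw hw'ρ hgm (hGlo w hw)
      · rw [Set.indicator_of_notMem hw, Set.indicator_of_notMem hw]
  -- (5) the model on the ball
  have h5 : c * (stiffGaussTop L (β / 2) β * Real.exp (-stiffGaussExp L (β / 2) β (chartVec w')) -
      Real.exp (-(β * (ρ - ρ') ^ 2 / 2)) * (π / (β / 2)) ^ ((Module.finrank ℝ (LinkSpace L) : ℝ) / 2)) ≤ c * ∫ w, ball.indicator m w :=
    mul_le_mul_of_nonneg_left (model_integral_chart_core_ge (L := L) (t := β / 2) (by positivity) hβ hρ'0 hρ'ρ hw') hc0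
  have h5' : ∫ w, ball.indicator (fun w => c * m w) w = c * ∫ w, ball.indicator m w := by
    rw [← integral_const_mul]
    refine integral_congr_ae (ae_of_all _ fun w => ?_)
    beta_reduce
    by_cases hw : w ∈ ball
    · rw [Set.indicator_of_mem hw, Set.indicator_of_mem hw]
    · rw [Set.indicator_of_notMem hw, Set.indicator_of_notMem hw, mul_zero]
  calc _ ≤ c * ∫ w, ball.indicator m w := h5
    _ = ∫ w, ball.indicator (fun w => c * m w) w := h5'.symm
    _ ≤ ∫ w, F w := h4
    _ = ∫ V, (gnCore L ρ).indicator (fun V => transferKernel su2Rep β U' V * G V) V ∂configMeasure SU2 L := h2.symm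
    _ ≤ _ := h1

/-- ★★★ **THE CENTRAL GAUSSIAN, UPPER BOUND.**  For `β > 0`, `0 < ρ ≤ 1/2`, `0 ≤ ρ'`, `4ρ' ≤ ρ`, a centre `P(w')` with `Σ_a w'_e a² ≤ ρ'²` on every link, and a measurable `0 ≤ G ≤ C_G` with
`G(P w) ≤ g₊·e^{−q(chartVec w)}` on the ball `Σ_a w_e a² ≤ ρ²` (`q = stiffGaussExp L (β/2) β`):
`∫ K_β(P w', V)·G(V) dμ(V) ≤ e^{2β|E|}(2π²)^{−|E|}e^{2000|P|ρ³β}e^{8|E|βρ⁴}·g₊·stiffGaussTop L (β/2) β·e^{−q(chartVec w')} + C_G·e^{2β|E|}e^{−βρ²/4}`. [cite: Luscher1983, §3] [cite: Wipf2021, §8.5.2] -/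
theorem central_gaussian_upper {β : ℝ} (hβ : 0 < β) {ρ ρ' : ℝ} (hρ : 0 < ρ) (hρ2 : ρ ≤ 1 / 2) (hρ'0 : 0 ≤ ρ') (hρ' : 4 * ρ' ≤ ρ) {w' : Edge 3 L → Fin 3 → ℝ}
    (hw' : ∀ e, ∑ a, w' e a ^ 2 ≤ ρ' ^ 2) {G : GaugeConfig 3 L SU2 → ℝ} (hGm : Measurable G) {CG : ℝ} (hCG : ∀ V, |G V| ≤ CG) (hG0 : ∀ V, 0 ≤ G V) {gp : ℝ}
    (hGhi : ∀ w : Edge 3 L → Fin 3 → ℝ, (∀ e, ∑ a, w e a ^ 2 ≤ ρ ^ 2) → G (latPatternChart L (fun _ => false) w) ≤ gp * Real.exp (-stiffGaussExp L (β / 2) β (chartVec w))) :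
    ∫ V, transferKernel su2Rep β (latPatternChart L (fun _ => false) w') V * G V ∂configMeasure SU2 L ≤
      Real.exp (2 * β) ^ Fintype.card (Edge 3 L) * ((2 * π ^ 2)⁻¹) ^ Fintype.card (Edge 3 L) * Real.exp (2000 * Fintype.card (Plaquette 3 L) * ρ ^ 3 * β) *
          Real.exp (8 * Fintype.card (Edge 3 L) * β * ρ ^ 4) * gp * (stiffGaussTop L (β / 2) β * Real.exp (-stiffGaussExp L (β / 2) β (chartVec w'))) +
        CG * (Real.exp (2 * β) ^ Fintype.card (Edge 3 L) * Real.exp (-(β * ρ ^ 2 / 4))) := by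
  have hβ0 : 0 ≤ β := hβ.le
  have hρ'ρ : ρ' ≤ ρ := by linarith
  have hw'ρ : ∀ e, ∑ a, w' e a ^ 2 ≤ ρ ^ 2 := fun e => (hw' e).trans (pow_le_pow_left₀ hρ'0 hρ'ρ 2)
  have hCG0 : 0 ≤ CG := (abs_nonneg _).trans (hCG 1)
  set U' := latPatternChart L (fun _ => false) w' with hU'
  set ball : Set (Edge 3 L → Fin 3 → ℝ) := {w | ∀ e, ∑ a, w e a ^ 2 ≤ ρ ^ 2} with hball
  set chi : ℝ := Real.exp (2 * β) ^ Fintype.card (Edge 3 L) * ((2 * π ^ 2)⁻¹) ^ Fintype.card (Edge 3 L) * Real.exp (2000 * Fintype.card (Plaquette 3 L) * ρ ^ 3 * β) *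
    Real.exp (8 * Fintype.card (Edge 3 L) * β * ρ ^ 4) with hchi
  set far : ℝ := Real.exp (2 * β) ^ Fintype.card (Edge 3 L) * Real.exp (-(β * ρ ^ 2 / 4)) with hfar
  set m : (Edge 3 L → Fin 3 → ℝ) → ℝ := fun w => Real.exp (-⟪chartVec w', ((β / 2) • stiffHessian L) (chartVec w')⟫) * Real.exp (-(β * ‖chartVec w' - chartVec w‖ ^ 2)) *
    Real.exp (-⟪chartVec w, ((β / 2) • stiffHessian L) (chartVec w)⟫) * Real.exp (-stiffGaussExp L (β / 2) β (chartVec w)) with hm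
  set F : (Edge 3 L → Fin 3 → ℝ) → ℝ := fun w => ball.indicator (fun w => latGnDensityReal L w * transferKernel su2Rep β U' (latPatternChart L (fun _ => false) w) *
    G (latPatternChart L (fun _ => false) w)) w with hF
  obtain ⟨M, hM0, hM, hintKG, hintS⟩ := integrable_transferKernel_mul β U' hGm hCG
  -- `gp ≥ 0`: the centre lies in the ball
  have hgp : 0 ≤ gp := by
    have h := (hG0 _).trans (hGhi w' hw'ρ)
    exact nonneg_of_mul_nonneg_left (by rwa [mul_comm] at h) (Real.exp_pos _)
  have hchi0 : 0 ≤ chi := by positivity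
  -- (1) split core / off-core
  have h1 : ∫ V, transferKernel su2Rep β U' V * G V ∂configMeasure SU2 L =
      (∫ V, (gnCore L ρ).indicator (fun V => transferKernel su2Rep β U' V * G V) V ∂configMeasure SU2 L) +
        ∫ V, (gnCore L ρ)ᶜ.indicator (fun V => transferKernel su2Rep β U' V * G V) V ∂configMeasure SU2 L := by
    rw [← integral_add (hintS _ (measurableSet_gnCore ρ)) (hintS _ (measurableSet_gnCore ρ).compl)]
    refine integral_congr_ae (ae_of_all _ fun V => ?_)
    beta_reduce
    by_cases hV : V ∈ gnCore L ρ
    · rw [Set.indicator_of_mem hV, Set.indicator_of_notMem (Set.notMem_compl_iff.2 hV), add_zero]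
    · rw [Set.indicator_of_notMem hV, Set.indicator_of_mem (Set.mem_compl hV), zero_add]
  -- (2) the off-core part
  have h2 : ∫ V, (gnCore L ρ)ᶜ.indicator (fun V => transferKernel su2Rep β U' V * G V) V ∂configMeasure SU2 L ≤ CG * far := by
    have hpt : ∀ V, (gnCore L ρ)ᶜ.indicator (fun V => transferKernel su2Rep β U' V * G V) V ≤ CG * far := fun V => by
      by_cases hV : V ∈ (gnCore L ρ)ᶜ
      · rw [Set.indicator_of_mem hV]
        have hK : transferKernel su2Rep β U' V ≤ far := transferKernel_far_le (L := L) hβ0 hρ hρ2 hρ'0 hρ' hw' (V := V) hV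
        calc transferKernel su2Rep β U' V * G V ≤ far * CG := mul_le_mul hK ((le_abs_self _).trans (hCG V)) (hG0 V) (by positivity)
          _ = CG * far := mul_comm _ _
      · rw [Set.indicator_of_notMem hV]; positivity
    calc _ ≤ ∫ _V, CG * far ∂configMeasure SU2 L := integral_mono (hintS _ (measurableSet_gnCore ρ).compl) (integrable_const _) hpt
      _ = CG * far := by simp
  -- (3) the core part in the chart, dominated by `chi · gp · m`
  have h3 : ∫ V, (gnCore L ρ).indicator (fun V => transferKernel su2Rep β U' V * G V) V ∂configMeasure SU2 L = ∫ w, F w := core_part_eq_chart β ρ w' hGm hCG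
  have hmint : Integrable m := integrable_model_integrand_chart (t := β / 2) (by positivity) hβ (chartVec w')
  have hF0 : ∀ w, 0 ≤ F w := fun w => by
    simp only [hF]
    by_cases hw : w ∈ ball
    · rw [Set.indicator_of_mem hw]
      exact mul_nonneg (mul_nonneg (latGnDensityReal_pos_le L w).1.le (transferKernel_pos su2Rep β _ _).le) (hG0 _)
    · rw [Set.indicator_of_notMem hw]
  have hFle : ∀ w, F w ≤ chi * gp * m w := fun w => by
    simp only [hF, hm]
    by_cases hw : w ∈ ball
    · rw [Set.indicator_of_mem hw]
      refine (chart_integrand_upper (L := L) hβ0 hρ.le hρ2 hw hw'ρ (hG0 _) (hGhi w hw)).trans (le_of_eq ?_)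
      rw [← hchi]; ring
    · rw [Set.indicator_of_notMem hw]
      exact mul_nonneg (mul_nonneg hchi0 hgp) (model_integrand_nonneg (β / 2) β (chartVec w') (chartVec w))
  have h4 : ∫ w, F w ≤ chi * gp * (stiffGaussTop L (β / 2) β * Real.exp (-stiffGaussExp L (β / 2) β (chartVec w'))) := by
    calc ∫ w, F w ≤ ∫ w, chi * gp * m w := integral_mono_of_nonneg (ae_of_all _ hF0) (hmint.const_mul (chi * gp)) (ae_of_all _ hFle)
      _ = chi * gp * ∫ w, m w := integral_const_mul _ _
      _ = chi * gp * (stiffGaussTop L (β / 2) β * Real.exp (-stiffGaussExp L (β / 2) β (chartVec w'))) := by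
          rw [hm, model_integral_chart (t := β / 2) (by positivity) hβ (chartVec w')]
  rw [h1, h3]
  linarith

/-! ## §6 The lower bound with a LOCAL Gaussian hypothesis

The profile of record vanishes outside its support ball, so a Gaussian lower bound on `G` can only hold near the centre.  The lower evaluation needs it only within Euclidean chart distance `R₀`
of the centre: the model mass farther out is part of the tail. -/

/-- The chart integrand `𝟙_ball·(∏ w(w_e))·K_β(P w', P w)·G(P w)` is non-negative, dominated by a shifted Gaussian, and integrable. [folklore] -/
theorem integrable_chart_integrand {β : ℝ} (hβ : 0 < β) {ρ : ℝ} (hρ0 : 0 ≤ ρ) (hρ2 : ρ ≤ 1 / 2) {w' : Edge 3 L → Fin 3 → ℝ} (hw' : ∀ e, ∑ a, w' e a ^ 2 ≤ ρ ^ 2)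
    {G : GaugeConfig 3 L SU2 → ℝ} (hGm : Measurable G) {CG : ℝ} (hCG : ∀ V, |G V| ≤ CG) (hG0 : ∀ V, 0 ≤ G V) :
    (∀ w, 0 ≤ {w : Edge 3 L → Fin 3 → ℝ | ∀ e, ∑ a, w e a ^ 2 ≤ ρ ^ 2}.indicator
        (fun w => latGnDensityReal L w * transferKernel su2Rep β (latPatternChart L (fun _ => false) w') (latPatternChart L (fun _ => false) w) *
          G (latPatternChart L (fun _ => false) w)) w) ∧
      Integrable (fun w : Edge 3 L → Fin 3 → ℝ => {w : Edge 3 L → Fin 3 → ℝ | ∀ e, ∑ a, w e a ^ 2 ≤ ρ ^ 2}.indicator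
        (fun w => latGnDensityReal L w * transferKernel su2Rep β (latPatternChart L (fun _ => false) w') (latPatternChart L (fun _ => false) w) *
          G (latPatternChart L (fun _ => false) w)) w) := by
  have hβ0 : 0 ≤ β := hβ.le
  have hCG0 : 0 ≤ CG := (abs_nonneg _).trans (hCG 1)
  set ball : Set (Edge 3 L → Fin 3 → ℝ) := {w | ∀ e, ∑ a, w e a ^ 2 ≤ ρ ^ 2} with hball
  set chi : ℝ := Real.exp (2 * β) ^ Fintype.card (Edge 3 L) * ((2 * π ^ 2)⁻¹) ^ Fintype.card (Edge 3 L) * Real.exp (2000 * Fintype.card (Plaquette 3 L) * ρ ^ 3 * β) *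
    Real.exp (8 * Fintype.card (Edge 3 L) * β * ρ ^ 4) with hchi
  set F : (Edge 3 L → Fin 3 → ℝ) → ℝ := fun w => ball.indicator (fun w => latGnDensityReal L w * transferKernel su2Rep β (latPatternChart L (fun _ => false) w')
    (latPatternChart L (fun _ => false) w) * G (latPatternChart L (fun _ => false) w)) w with hF
  have hFm : Measurable F := measurable_chart_integrand β ρ w' hGm
  have hF0 : ∀ w, 0 ≤ F w := fun w => by
    simp only [hF]
    by_cases hw : w ∈ ball
    · rw [Set.indicator_of_mem hw]
      exact mul_nonneg (mul_nonneg (latGnDensityReal_pos_le L w).1.le (transferKernel_pos su2Rep β _ _).le) (hG0 _)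
    · rw [Set.indicator_of_notMem hw]
  have hFle : ∀ w, F w ≤ chi * CG * Real.exp (-(β * ‖chartVec w' - chartVec w‖ ^ 2)) := fun w => by
    simp only [hF]
    by_cases hw : w ∈ ball
    · rw [Set.indicator_of_mem hw]
      refine (chart_integrand_upper (L := L) hβ0 hρ0 hρ2 hw hw' (hG0 _) ((le_abs_self _).trans (hCG (latPatternChart L (fun _ => false) w)))).trans ?_
      have hE1 : Real.exp (-⟪chartVec w', ((β / 2) • stiffHessian L) (chartVec w')⟫) ≤ 1 :=
        Real.exp_le_one_iff.2 (neg_nonpos.2 (inner_smul_stiffHessian_nonneg (by positivity) _))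
      have hE3 : Real.exp (-⟪chartVec w, ((β / 2) • stiffHessian L) (chartVec w)⟫) ≤ 1 :=
        Real.exp_le_one_iff.2 (neg_nonpos.2 (inner_smul_stiffHessian_nonneg (by positivity) _))
      rw [← hchi]
      calc chi * CG * (Real.exp (-⟪chartVec w', ((β / 2) • stiffHessian L) (chartVec w')⟫) * Real.exp (-(β * ‖chartVec w' - chartVec w‖ ^ 2)) *
            Real.exp (-⟪chartVec w, ((β / 2) • stiffHessian L) (chartVec w)⟫))
          ≤ chi * CG * (1 * Real.exp (-(β * ‖chartVec w' - chartVec w‖ ^ 2)) * 1) := by gcongr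
        _ = chi * CG * Real.exp (-(β * ‖chartVec w' - chartVec w‖ ^ 2)) := by ring
    · rw [Set.indicator_of_notMem hw]; positivity
  exact ⟨hF0, Integrable.mono' ((integrable_gauss_shift_chart hβ (chartVec w')).const_mul (chi * CG)) hFm.aestronglyMeasurable
    (ae_of_all _ fun w => by rw [Real.norm_eq_abs, abs_of_nonneg (hF0 w)]; exact hFle w)⟩

/-- ★★★ **THE CENTRAL GAUSSIAN, LOWER BOUND WITH A LOCAL HYPOTHESIS.**  As `central_gaussian_lower`, but the Gaussian lower bound `g₋·e^{−q(chartVec w)} ≤ G(P w)` is only assumed for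
chart points `w` of the ball with `‖chartVec w − chartVec w'‖ ≤ R₀`; the price is the tail radius `min(ρ − ρ', R₀)`:
`e^{2β|E|}((2π²)⁻¹(1+ρ²)⁻²)^{|E|}e^{−2000|P|ρ³β}·g₋·(stiffGaussTop·e^{−q(chartVec w')} − e^{−β·min(ρ−ρ',R₀)²/2}(π/(β/2))^{dim/2}) ≤ ∫ K_β(P w', V)·G(V) dμ(V)`.
[cite: Luscher1983, §3] [cite: Wipf2021, §8.5.2] -/
theorem central_gaussian_lower_local {β : ℝ} (hβ : 0 < β) {ρ ρ' : ℝ} (hρ : 0 < ρ) (hρ2 : ρ ≤ 1 / 2) (hρ'0 : 0 ≤ ρ') (hρ' : 4 * ρ' ≤ ρ) {w' : Edge 3 L → Fin 3 → ℝ}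
    (hw' : ∀ e, ∑ a, w' e a ^ 2 ≤ ρ' ^ 2) {G : GaugeConfig 3 L SU2 → ℝ} (hGm : Measurable G) {CG : ℝ} (hCG : ∀ V, |G V| ≤ CG) (hG0 : ∀ V, 0 ≤ G V) {gm : ℝ} (hgm : 0 ≤ gm)
    {R₀ : ℝ} (hR₀ : 0 ≤ R₀)
    (hGlo : ∀ w : Edge 3 L → Fin 3 → ℝ, (∀ e, ∑ a, w e a ^ 2 ≤ ρ ^ 2) → ‖chartVec w - chartVec w'‖ ≤ R₀ →
      gm * Real.exp (-stiffGaussExp L (β / 2) β (chartVec w)) ≤ G (latPatternChart L (fun _ => false) w)) :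
    Real.exp (2 * β) ^ Fintype.card (Edge 3 L) * ((2 * π ^ 2)⁻¹ * ((1 + ρ ^ 2)⁻¹) ^ 2) ^ Fintype.card (Edge 3 L) *
          Real.exp (-(2000 * Fintype.card (Plaquette 3 L) * ρ ^ 3 * β)) * gm *
        (stiffGaussTop L (β / 2) β * Real.exp (-stiffGaussExp L (β / 2) β (chartVec w')) -
          Real.exp (-(β * (min (ρ - ρ') R₀) ^ 2 / 2)) * (π / (β / 2)) ^ ((Module.finrank ℝ (LinkSpace L) : ℝ) / 2)) ≤
      ∫ V, transferKernel su2Rep β (latPatternChart L (fun _ => false) w') V * G V ∂configMeasure SU2 L := by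
  have hβ0 : 0 ≤ β := hβ.le
  have hρ'ρ : ρ' ≤ ρ := by linarith
  have hw'ρ : ∀ e, ∑ a, w' e a ^ 2 ≤ ρ ^ 2 := fun e => (hw' e).trans (pow_le_pow_left₀ hρ'0 hρ'ρ 2)
  set U' := latPatternChart L (fun _ => false) w' with hU'
  set x' : LinkSpace L := chartVec w' with hx'
  set ball : Set (Edge 3 L → Fin 3 → ℝ) := {w | ∀ e, ∑ a, w e a ^ 2 ≤ ρ ^ 2} with hball
  set c : ℝ := Real.exp (2 * β) ^ Fintype.card (Edge 3 L) * ((2 * π ^ 2)⁻¹ * ((1 + ρ ^ 2)⁻¹) ^ 2) ^ Fintype.card (Edge 3 L) *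
    Real.exp (-(2000 * Fintype.card (Plaquette 3 L) * ρ ^ 3 * β)) * gm with hc
  have hc0 : 0 ≤ c := by positivity
  set m : LinkSpace L → ℝ := fun y => Real.exp (-⟪x', ((β / 2) • stiffHessian L) x'⟫) * Real.exp (-(β * ‖x' - y‖ ^ 2)) *
    Real.exp (-⟪y, ((β / 2) • stiffHessian L) y⟫) * Real.exp (-stiffGaussExp L (β / 2) β y) with hm
  set F : (Edge 3 L → Fin 3 → ℝ) → ℝ := fun w => ball.indicator (fun w => latGnDensityReal L w * transferKernel su2Rep β U' (latPatternChart L (fun _ => false) w) *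
    G (latPatternChart L (fun _ => false) w)) w with hF
  obtain ⟨M, hM0, hM, hintKG, hintS⟩ := integrable_transferKernel_mul β U' hGm hCG
  -- (1) `∫ K G ≥ ∫ 𝟙_core K G = ∫ F`
  have h1 : ∫ V, (gnCore L ρ).indicator (fun V => transferKernel su2Rep β U' V * G V) V ∂configMeasure SU2 L ≤ ∫ V, transferKernel su2Rep β U' V * G V ∂configMeasure SU2 L := by
    refine integral_mono (hintS _ (measurableSet_gnCore ρ)) hintKG fun V => ?_
    beta_reduce
    by_cases hV : V ∈ gnCore L ρ
    · rw [Set.indicator_of_mem hV]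
    · rw [Set.indicator_of_notMem hV]; exact mul_nonneg (transferKernel_pos su2Rep β _ _).le (hG0 V)
  have h2 : ∫ V, (gnCore L ρ).indicator (fun V => transferKernel su2Rep β U' V * G V) V ∂configMeasure SU2 L = ∫ w, F w := core_part_eq_chart β ρ w' hGm hCG
  obtain ⟨hF0, hFint⟩ := integrable_chart_integrand (L := L) hβ hρ.le hρ2 hw'ρ hGm hCG hG0
  -- (2) the local core in `LinkSpace`
  set T : Set (LinkSpace L) := {y | (∀ e, ∑ a, linkCurry y e a ^ 2 ≤ ρ ^ 2) ∧ ‖y - x'‖ ≤ R₀} with hT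
  have hTm : MeasurableSet T := by
    have h1' : MeasurableSet {y : LinkSpace L | ∀ e, ∑ a, linkCurry y e a ^ 2 ≤ ρ ^ 2} := by
      have : {y : LinkSpace L | ∀ e, ∑ a, linkCurry y e a ^ 2 ≤ ρ ^ 2} = (chartEquiv L).symm ⁻¹' ball := by ext y; simp [hball, chartEquiv_symm_apply]
      rw [this]; exact (chartEquiv L).symm.measurable (measurableSet_chartBall ρ)
    have h2' : MeasurableSet {y : LinkSpace L | ‖y - x'‖ ≤ R₀} := measurableSet_le (measurable_id.sub_const x').norm measurable_const
    have : T = {y : LinkSpace L | ∀ e, ∑ a, linkCurry y e a ^ 2 ≤ ρ ^ 2} ∩ {y | ‖y - x'‖ ≤ R₀} := by ext y; simp [hT]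
    rw [this]; exact h1'.inter h2'
  have hfar : ∀ y, y ∉ T → min (ρ - ρ') R₀ ≤ ‖y - x'‖ := by
    intro y hy
    simp only [hT, Set.mem_setOf_eq, not_and_or, not_forall, not_le] at hy
    rcases hy with ⟨e, he⟩ | hy
    · have h := norm_chartVec_sub_ge_of_exit (L := L) hρ'0 hρ'ρ hw' (w := linkCurry y) he
      rw [chartVec_linkCurry] at h
      exact (min_le_left _ _).trans h
    · exact (min_le_right _ _).trans hy.le
  have hmodel := model_integral_on_ge (L := L) (t := β / 2) (by positivity) hβ x' hTm (le_min (by linarith) hR₀) hfar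
  -- (3) chart form of the local model integral and the pointwise comparison with `F`
  have h3 : ∫ y, T.indicator m y = ∫ w : Edge 3 L → Fin 3 → ℝ, T.indicator m (chartVec w) := (integral_comp_chartVec L (T.indicator m)).symm
  have h4 : ∫ w : Edge 3 L → Fin 3 → ℝ, c * T.indicator m (chartVec w) ≤ ∫ w, F w := by
    refine integral_mono_of_nonneg (ae_of_all _ fun w => mul_nonneg hc0 (Set.indicator_nonneg (fun y _ => model_integrand_nonneg (β / 2) β x' y) _)) hFint
      (ae_of_all _ fun w => ?_)
    beta_reduce
    by_cases hw : chartVec w ∈ T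
    · have hwT := hw
      simp only [hT, Set.mem_setOf_eq, linkCurry_chartVec] at hwT
      rw [Set.indicator_of_mem hw]
      show c * m (chartVec w) ≤ F w
      simp only [hF, hm, hc]
      rw [Set.indicator_of_mem (show w ∈ ball from hwT.1)]
      exact chart_integrand_lower (L := L) hβ0 hρ.le hρ2 hwT.1 hw'ρ hgm (hGlo w hwT.1 hwT.2)
    · rw [Set.indicator_of_notMem hw, mul_zero]; exact hF0 w
  have h5 : ∫ w : Edge 3 L → Fin 3 → ℝ, c * T.indicator m (chartVec w) = c * ∫ y, T.indicator m y := by rw [integral_const_mul, h3]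
  calc _ = c * (stiffGaussTop L (β / 2) β * Real.exp (-stiffGaussExp L (β / 2) β x') -
        Real.exp (-(β * (min (ρ - ρ') R₀) ^ 2 / 2)) * (π / (β / 2)) ^ ((Module.finrank ℝ (LinkSpace L) : ℝ) / 2)) := by rw [hc]
    _ ≤ c * ∫ y, T.indicator m y := mul_le_mul_of_nonneg_left hmodel hc0
    _ = ∫ w : Edge 3 L → Fin 3 → ℝ, c * T.indicator m (chartVec w) := h5.symm
    _ ≤ ∫ w, F w := h4
    _ = ∫ V, (gnCore L ρ).indicator (fun V => transferKernel su2Rep β U' V * G V) V ∂configMeasure SU2 L := h2.symm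
    _ ≤ _ := h1

end Summit.QuantumFields.YangMills.Theorems.FemtoTransferGap.TwoLattice.ConstTube

end
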